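import Summits.Ventures.LatticeQCDFlow.Scaling.DoeblinHotSampler
import Summits.Ventures.LatticeQCDFlow.Scaling.DominatedStarGapAndMixing

/-!
HONEST FRAMING: exact (Metropolis-corrected) sampling algorithms for lattice gauge theory; figures
of merit are autocorrelation/cost numbers at stated couplings and volumes; no continuum-physics
claim.

# DoeblinHotGapAndMixing — WITH A DOEBLIN-MINORISED HOT SAMPLER EVERY EIGENVALUE `λ ≠ 1` OF THE MAP-ASSISTED HUB STILL
# HAS `|λ| ≤ 1 − tcp/(2m)` ONCE `4t ≤ p(1−t)·a·w_0`: `γ⋆ ≥ tcp/(2m)`, `t_rel ≤ 2m/(tcp)`,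
# `(t_rel − 1)·log(1/(2ε)) ≤ t_mix(ε) ≤ ⌈(2m/(tcp))·log((2K+p)/(pε))⌉`; PERFECT TRANSPORTS: `λ⋆ ≤ 1 − t(1−t)·a·w_0·c/(2m)`
# (lean-2 GEN-27, ours)

Venture-side (OURS).  Cell `lqcd-flow` (pub-lqcd), unit `pub-lqcd-lean-2-g27`, 2026-08-27.  Doeblin-minorised hot
samplers, file 6.  Setting of `Scaling/DoeblinHotSampler` (`P = t·GSw + (1−t)·Π_w^M`, hub list `e_r = (0, κ_r+1)`
with multiplicities `≥ c`, maps `φ_r`, positive unit-mass laws `μ_k`, `μ_k`-REVERSIBLE single-site kernels `M_k`, the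
hot one with `M_0(u,·) ≥ a·μ_0(·)`, `0 < a ≤ 1`).  `Scaling/DominatedStarGapAndMixing` turned chapter M's distance
profile into spectral statements through the generic `lambdaStar_le_of_worstTvDist_le_geom` (Levin–Peres–Wilmer
(12.15) from the tree); the same two lines apply to the profile of `Scaling/DoeblinHotSampler`.

## What is proved

* §1 one-sided domination `p·μ_{l_r}(φ_r u) ≤ μ_0(u)` (`0 < p ≤ 1`), `4t ≤ p(1−t)·a·w_0`:
  **`doeblinStar_lambdaStar_le`** (`λ⋆ ≤ 1 − tcp/(2m)`), **`doeblinStar_absSpectralGap_ge`** (`γ⋆ ≥ tcp/(2m)`),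
  **`doeblinStar_relaxationTime_le`** (`t_rel ≤ 2m/(tcp)`), **`doeblinStar_relaxation_mixing_two_sided`**.
* §2 perfect transports (`0 < t < 1`, `w_0 > 0`): **`doeblinPerfectStar_lambdaStar_le`**
  (`λ⋆ ≤ 1 − t(1−t)·a·w_0·c/(2m)`), **`doeblinPerfectStar_absSpectralGap_ge`**, **`doeblinPerfectStar_relaxationTime_le`**
  (`t_rel ≤ 2m/(t(1−t)·a·w_0·c)`).

Reading (no numerics implied): a realistic (Metropolised-flow) hot level costs the spectral statements of chapter M
nothing but the discount `w_0 ↦ a·w_0` in the regime (one-sided maps) or in the rate (perfect maps).  NOT CLAIMED: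
anything without a whole-space minorisation of the hot kernel; anything measured.  Literature grade (cell rule): OWN
RESULT; `lambdaStar_le_of_worstTvDist_le_geom` and (12.14) are the tree's typed Levin–Peres–Wilmer statements, used as
lemmas; nothing new cited; no new bib keys.
-/

noncomputable section

open Finset Function
open Literature.Probability.MarkovChains

namespace Summit.Ventures.LatticeQCDFlow.Scaling

variable {S : Type*} [Fintype S] [DecidableEq S] {K m : ℕ} {μ : Fin (K + 1) → S → ℝ} {M : Fin (K + 1) → S → S → ℝ}
  {w : Fin (K + 1) → ℝ} {t p a : ℝ}

section Gap
variable (κ : Fin m → Fin K) (φ : Fin m → Equiv.Perm S)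

/-! ## §1 One-sided domination -/

/-- **EVERY EIGENVALUE `λ ≠ 1` HAS `|λ| ≤ 1 − tcp/(2m)`** for the map-assisted hub with a Doeblin-minorised hot sampler
(`M_0(u,·) ≥ a·μ_0`, `0 < a ≤ 1`), reversible single-site kernels, one-sided domination (`0 < p ≤ 1`),
`4t ≤ p(1−t)·a·w_0`, hub multiplicities `≥ c ≥ 1`. [ours] -/
theorem doeblinStar_lambdaStar_le (hm : 1 ≤ m) (ht0 : 0 ≤ t) (ht1 : t ≤ 1) (hw0 : ∀ k, 0 ≤ w k) (hw1 : ∑ k, w k = 1)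
    (hμ : ∀ k x, 0 < μ k x) (hμ1 : ∀ k, ∑ u, μ k u = 1) (hM : ∀ k, IsRowStochastic (M k))
    (hMrev : ∀ k, DetailedBalance (μ k) (M k)) (ha0 : 0 < a) (ha1 : a ≤ 1) (hmin : ∀ u v, a * μ 0 v ≤ M 0 u v)
    (hp0 : 0 < p) (hp1 : p ≤ 1) (hdom : ∀ r u, p * μ (κ r).succ (φ r u) ≤ μ 0 u)
    (hreg : 4 * t ≤ p * (1 - t) * (a * w 0))
    {c : ℕ} (hc1 : 1 ≤ c) (hc : ∀ p' : Fin K, c ≤ (univ.filter (fun r : Fin m => κ r = p')).card) (hcm : c ≤ m) :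
    lambdaStar (fun y z : Fin (K + 1) → S =>
        t * ptGraphSwap μ (fun r : Fin m => (((0 : Fin (K + 1)), (κ r).succ) : Fin (K + 1) × Fin (K + 1))) φ y z
          + (1 - t) * prodKernel w M y z) ≤ 1 - t * c * p / (2 * m) := by
  have hstat : ∀ (k : Fin (K + 1)) (v : S), ∑ u, μ k u * M k u v = μ k v := fun k v => (hMrev k).isStationary (hM k).2 v
  have hmpos : (0 : ℝ) < m := Nat.cast_pos.mpr (by omega)
  have hcm' : (c : ℝ) ≤ m := by exact_mod_cast hcm
  have hρ : 0 < 1 - t * c * p / (2 * m) := by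
    rw [sub_pos, div_lt_one (by positivity)]
    have h1 : t * c * p ≤ 1 * m * 1 := by
      have := mul_le_mul (mul_le_mul ht1 hcm' (Nat.cast_nonneg c) zero_le_one) hp1 hp0.le (by positivity)
      linarith
    linarith
  exact lambdaStar_le_of_worstTvDist_le_geom (dominatedStar_isStationary κ φ ht0 ht1 hw0 hw1 hμ hM hMrev) hρ
    (doeblinStar_worstTvDist_le κ φ hm ht0 ht1 hw0 hw1 hμ hμ1 hM hstat ha0 ha1 hmin hp0 hp1 hdom hreg hc1 hc hcm)

/-- **THE ABSOLUTE SPECTRAL GAP: `γ⋆ ≥ tcp/(2m)`** with a Doeblin-minorised hot sampler, once `4t ≤ p(1−t)·a·w_0`. [ours] -/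
theorem doeblinStar_absSpectralGap_ge (hm : 1 ≤ m) (ht0 : 0 ≤ t) (ht1 : t ≤ 1) (hw0 : ∀ k, 0 ≤ w k)
    (hw1 : ∑ k, w k = 1) (hμ : ∀ k x, 0 < μ k x) (hμ1 : ∀ k, ∑ u, μ k u = 1) (hM : ∀ k, IsRowStochastic (M k))
    (hMrev : ∀ k, DetailedBalance (μ k) (M k)) (ha0 : 0 < a) (ha1 : a ≤ 1) (hmin : ∀ u v, a * μ 0 v ≤ M 0 u v)
    (hp0 : 0 < p) (hp1 : p ≤ 1) (hdom : ∀ r u, p * μ (κ r).succ (φ r u) ≤ μ 0 u)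
    (hreg : 4 * t ≤ p * (1 - t) * (a * w 0))
    {c : ℕ} (hc1 : 1 ≤ c) (hc : ∀ p' : Fin K, c ≤ (univ.filter (fun r : Fin m => κ r = p')).card) (hcm : c ≤ m) :
    t * c * p / (2 * m) ≤ absSpectralGap (fun y z : Fin (K + 1) → S =>
        t * ptGraphSwap μ (fun r : Fin m => (((0 : Fin (K + 1)), (κ r).succ) : Fin (K + 1) × Fin (K + 1))) φ y z
          + (1 - t) * prodKernel w M y z) := by
  unfold absSpectralGap
  linarith [doeblinStar_lambdaStar_le κ φ hm ht0 ht1 hw0 hw1 hμ hμ1 hM hMrev ha0 ha1 hmin hp0 hp1 hdom hreg hc1 hc hcm]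

/-- **THE RELAXATION TIME: `t_rel ≤ 2m/(tcp)`** with a Doeblin-minorised hot sampler, once `4t ≤ p(1−t)·a·w_0` (`0 < t`).
[ours] -/
theorem doeblinStar_relaxationTime_le (hm : 1 ≤ m) (ht0 : 0 < t) (ht1 : t ≤ 1) (hw0 : ∀ k, 0 ≤ w k)
    (hw1 : ∑ k, w k = 1) (hμ : ∀ k x, 0 < μ k x) (hμ1 : ∀ k, ∑ u, μ k u = 1) (hM : ∀ k, IsRowStochastic (M k))
    (hMrev : ∀ k, DetailedBalance (μ k) (M k)) (ha0 : 0 < a) (ha1 : a ≤ 1) (hmin : ∀ u v, a * μ 0 v ≤ M 0 u v)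
    (hp0 : 0 < p) (hp1 : p ≤ 1) (hdom : ∀ r u, p * μ (κ r).succ (φ r u) ≤ μ 0 u)
    (hreg : 4 * t ≤ p * (1 - t) * (a * w 0))
    {c : ℕ} (hc1 : 1 ≤ c) (hc : ∀ p' : Fin K, c ≤ (univ.filter (fun r : Fin m => κ r = p')).card) (hcm : c ≤ m) :
    relaxationTime (fun y z : Fin (K + 1) → S =>
        t * ptGraphSwap μ (fun r : Fin m => (((0 : Fin (K + 1)), (κ r).succ) : Fin (K + 1) × Fin (K + 1))) φ y z
          + (1 - t) * prodKernel w M y z) ≤ 2 * m / (t * c * p) := by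
  have hmpos : (0 : ℝ) < m := Nat.cast_pos.mpr (by omega)
  have hcpos : (0 : ℝ) < c := Nat.cast_pos.mpr (by omega)
  have hgap := doeblinStar_absSpectralGap_ge κ φ hm ht0.le ht1 hw0 hw1 hμ hμ1 hM hMrev ha0 ha1 hmin hp0 hp1 hdom hreg hc1
    hc hcm
  have hpos : 0 < t * c * p / (2 * m) := by positivity
  unfold relaxationTime
  calc 1 / absSpectralGap _ ≤ 1 / (t * c * p / (2 * m)) := one_div_le_one_div_of_le hpos hgap
    _ = 2 * m / (t * c * p) := by rw [one_div_div]

/-- **RELAXATION AND MIXING FROM BOTH SIDES with a Doeblin-minorised hot sampler: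
`(t_rel − 1)·log(1/(2ε)) ≤ t_mix(ε) ≤ ⌈(2m/(tcp))·log((2K+p)/(pε))⌉`** (`0 < ε`, `0 < t`, `4t ≤ p(1−t)·a·w_0`). [ours] -/
theorem doeblinStar_relaxation_mixing_two_sided (hm : 1 ≤ m) (ht0 : 0 < t) (ht1 : t ≤ 1) (hw0 : ∀ k, 0 ≤ w k)
    (hw1 : ∑ k, w k = 1) (hμ : ∀ k x, 0 < μ k x) (hμ1 : ∀ k, ∑ u, μ k u = 1) (hM : ∀ k, IsRowStochastic (M k))
    (hMrev : ∀ k, DetailedBalance (μ k) (M k)) (ha0 : 0 < a) (ha1 : a ≤ 1) (hmin : ∀ u v, a * μ 0 v ≤ M 0 u v)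
    (hp0 : 0 < p) (hp1 : p ≤ 1) (hdom : ∀ r u, p * μ (κ r).succ (φ r u) ≤ μ 0 u)
    (hreg : 4 * t ≤ p * (1 - t) * (a * w 0))
    {c : ℕ} (hc1 : 1 ≤ c) (hc : ∀ p' : Fin K, c ≤ (univ.filter (fun r : Fin m => κ r = p')).card) (hcm : c ≤ m)
    {ε : ℝ} (hε : 0 < ε) :
    (relaxationTime (fun y z : Fin (K + 1) → S =>
        t * ptGraphSwap μ (fun r : Fin m => (((0 : Fin (K + 1)), (κ r).succ) : Fin (K + 1) × Fin (K + 1))) φ y z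
          + (1 - t) * prodKernel w M y z) - 1) * Real.log (1 / (2 * ε))
        ≤ (mixingTime (fun y z : Fin (K + 1) → S =>
            t * ptGraphSwap μ (fun r : Fin m => (((0 : Fin (K + 1)), (κ r).succ) : Fin (K + 1) × Fin (K + 1))) φ y z
              + (1 - t) * prodKernel w M y z) (tensorFun μ) ε : ℝ) ∧
      mixingTime (fun y z : Fin (K + 1) → S =>
            t * ptGraphSwap μ (fun r : Fin m => (((0 : Fin (K + 1)), (κ r).succ) : Fin (K + 1) × Fin (K + 1))) φ y z
              + (1 - t) * prodKernel w M y z) (tensorFun μ) ε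
        ≤ ⌈2 * (m : ℝ) / (t * c * p) * Real.log ((2 * (K : ℝ) + p) / (p * ε))⌉₊ := by
  have hstat : ∀ (k : Fin (K + 1)) (v : S), ∑ u, μ k u * M k u v = μ k v := fun k v => (hMrev k).isStationary (hM k).2 v
  have hmpos : (0 : ℝ) < m := Nat.cast_pos.mpr (by omega)
  have hcpos : (0 : ℝ) < c := Nat.cast_pos.mpr (by omega)
  have hmix := doeblinStar_mixingTime_le κ φ hm ht0 ht1 hw0 hw1 hμ hμ1 hM hstat ha0 ha1 hmin hp0 hp1 hdom hreg hc1 hc hcm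
    hε
  refine ⟨?_, hmix⟩
  have hlam : lambdaStar (fun y z : Fin (K + 1) → S =>
      t * ptGraphSwap μ (fun r : Fin m => (((0 : Fin (K + 1)), (κ r).succ) : Fin (K + 1) × Fin (K + 1))) φ y z
        + (1 - t) * prodKernel w M y z) < 1 := by
    have h := doeblinStar_lambdaStar_le κ φ hm ht0.le ht1 hw0 hw1 hμ hμ1 hM hMrev ha0 ha1 hmin hp0 hp1 hdom hreg hc1 hc
      hcm
    have hpos : 0 < t * c * p / (2 * m) := by positivity
    linarith
  have hd : worstTvDist (fun y z : Fin (K + 1) → S =>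
      t * ptGraphSwap μ (fun r : Fin m => (((0 : Fin (K + 1)), (κ r).succ) : Fin (K + 1) × Fin (K + 1))) φ y z
        + (1 - t) * prodKernel w M y z) (tensorFun μ)
      ⌈2 * (m : ℝ) / (t * c * p) * Real.log ((2 * (K : ℝ) + p) / (p * ε))⌉₊ ≤ ε := by
    refine (doeblinStar_worstTvDist_le κ φ hm ht0.le ht1 hw0 hw1 hμ hμ1 hM hstat ha0 ha1 hmin hp0 hp1 hdom hreg hc1 hc
      hcm _).trans ?_
    have hcm' : (c : ℝ) ≤ m := by exact_mod_cast hcm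
    have hq0 : 0 < t * c * p / (2 * m) := by positivity
    have hq1 : t * c * p / (2 * m) ≤ 1 := by
      rw [div_le_one (by positivity)]
      have h1 : t * c ≤ 1 * m := by nlinarith
      nlinarith
    have hC : 0 < (2 * (K : ℝ) + p) / p := by positivity
    refine geom_le_of_ge_log hq0 hq1 hC hε ?_
    have e1 : 1 / (t * c * p / (2 * m)) = 2 * (m : ℝ) / (t * c * p) := by field_simp
    have e2 : (2 * (K : ℝ) + p) / p / ε = (2 * (K : ℝ) + p) / (p * ε) := by rw [div_div]
    rw [e1, e2]; exact Nat.le_ceil _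
  exact LevinPeres2017_eq_12_14_tmix (dominatedStar_isStationary κ φ ht0.le ht1 hw0 hw1 hμ hM hMrev) hlam hε ⟨_, hd⟩

/-! ## §2 Perfect transports -/

/-- **PERFECT TRANSPORTS WITH A DOEBLIN-MINORISED HOT SAMPLER: `λ⋆ ≤ 1 − t(1−t)·a·w_0·c/(2m)`** (`0 < t < 1`,
`w_0 > 0`, `0 < a ≤ 1`, reversible single-site kernels). [ours] -/
theorem doeblinPerfectStar_lambdaStar_le (hm : 1 ≤ m) (ht0 : 0 < t) (ht1 : t < 1) (hw0 : ∀ k, 0 ≤ w k)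
    (hw00 : 0 < w 0) (hw1 : ∑ k, w k = 1) (hμ : ∀ k x, 0 < μ k x) (hμ1 : ∀ k, ∑ u, μ k u = 1)
    (hM : ∀ k, IsRowStochastic (M k)) (hMrev : ∀ k, DetailedBalance (μ k) (M k)) (ha0 : 0 < a) (ha1 : a ≤ 1)
    (hmin : ∀ u v, a * μ 0 v ≤ M 0 u v) (hperf : ∀ r u, μ (κ r).succ (φ r u) = μ 0 u)
    {c : ℕ} (hc1 : 1 ≤ c) (hc : ∀ p' : Fin K, c ≤ (univ.filter (fun r : Fin m => κ r = p')).card) (hcm : c ≤ m) :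
    lambdaStar (fun y z : Fin (K + 1) → S =>
        t * ptGraphSwap μ (fun r : Fin m => (((0 : Fin (K + 1)), (κ r).succ) : Fin (K + 1) × Fin (K + 1))) φ y z
          + (1 - t) * prodKernel w M y z) ≤ 1 - t * (1 - t) * (a * w 0) * c / (2 * m) := by
  have hstat : ∀ (k : Fin (K + 1)) (v : S), ∑ u, μ k u * M k u v = μ k v := fun k v => (hMrev k).isStationary (hM k).2 v
  have hmpos : (0 : ℝ) < m := Nat.cast_pos.mpr (by omega)
  have hcm' : (c : ℝ) ≤ m := by exact_mod_cast hcm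
  have hw01 : w 0 ≤ 1 := by
    have h := Finset.single_le_sum (f := w) (fun k _ => hw0 k) (mem_univ (0 : Fin (K + 1)))
    rw [hw1] at h; exact h
  have haw : a * w 0 ≤ 1 := by nlinarith
  have hρ : 0 < 1 - t * (1 - t) * (a * w 0) * c / (2 * m) := by
    rw [sub_pos, div_lt_one (by positivity)]
    have h1 : t * (1 - t) ≤ 1 := by nlinarith
    have h2 : t * (1 - t) * (a * w 0) ≤ 1 := by
      have := mul_le_mul h1 haw (by positivity) zero_le_one
      nlinarith
    have h3 : t * (1 - t) * (a * w 0) * c ≤ 1 * m := by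
      have h1t : 0 ≤ t * (1 - t) * (a * w 0) := by
        have : 0 ≤ 1 - t := by linarith
        positivity
      nlinarith
    linarith
  exact lambdaStar_le_of_worstTvDist_le_geom (dominatedStar_isStationary κ φ ht0.le ht1.le hw0 hw1 hμ hM hMrev) hρ
    (doeblinPerfectStar_worstTvDist_le κ φ hm ht0 ht1 hw0 hw00 hw1 hμ hμ1 hM hstat ha0 ha1 hmin hperf hc1 hc hcm)

/-- **PERFECT TRANSPORTS: `γ⋆ ≥ t(1−t)·a·w_0·c/(2m)`** with a Doeblin-minorised hot sampler. [ours] -/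
theorem doeblinPerfectStar_absSpectralGap_ge (hm : 1 ≤ m) (ht0 : 0 < t) (ht1 : t < 1) (hw0 : ∀ k, 0 ≤ w k)
    (hw00 : 0 < w 0) (hw1 : ∑ k, w k = 1) (hμ : ∀ k x, 0 < μ k x) (hμ1 : ∀ k, ∑ u, μ k u = 1)
    (hM : ∀ k, IsRowStochastic (M k)) (hMrev : ∀ k, DetailedBalance (μ k) (M k)) (ha0 : 0 < a) (ha1 : a ≤ 1)
    (hmin : ∀ u v, a * μ 0 v ≤ M 0 u v) (hperf : ∀ r u, μ (κ r).succ (φ r u) = μ 0 u)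
    {c : ℕ} (hc1 : 1 ≤ c) (hc : ∀ p' : Fin K, c ≤ (univ.filter (fun r : Fin m => κ r = p')).card) (hcm : c ≤ m) :
    t * (1 - t) * (a * w 0) * c / (2 * m) ≤ absSpectralGap (fun y z : Fin (K + 1) → S =>
        t * ptGraphSwap μ (fun r : Fin m => (((0 : Fin (K + 1)), (κ r).succ) : Fin (K + 1) × Fin (K + 1))) φ y z
          + (1 - t) * prodKernel w M y z) := by
  unfold absSpectralGap
  linarith [doeblinPerfectStar_lambdaStar_le κ φ hm ht0 ht1 hw0 hw00 hw1 hμ hμ1 hM hMrev ha0 ha1 hmin hperf hc1 hc hcm]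

/-- **PERFECT TRANSPORTS: `t_rel ≤ 2m/(t(1−t)·a·w_0·c)`** with a Doeblin-minorised hot sampler. [ours] -/
theorem doeblinPerfectStar_relaxationTime_le (hm : 1 ≤ m) (ht0 : 0 < t) (ht1 : t < 1) (hw0 : ∀ k, 0 ≤ w k)
    (hw00 : 0 < w 0) (hw1 : ∑ k, w k = 1) (hμ : ∀ k x, 0 < μ k x) (hμ1 : ∀ k, ∑ u, μ k u = 1)
    (hM : ∀ k, IsRowStochastic (M k)) (hMrev : ∀ k, DetailedBalance (μ k) (M k)) (ha0 : 0 < a) (ha1 : a ≤ 1)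
    (hmin : ∀ u v, a * μ 0 v ≤ M 0 u v) (hperf : ∀ r u, μ (κ r).succ (φ r u) = μ 0 u)
    {c : ℕ} (hc1 : 1 ≤ c) (hc : ∀ p' : Fin K, c ≤ (univ.filter (fun r : Fin m => κ r = p')).card) (hcm : c ≤ m) :
    relaxationTime (fun y z : Fin (K + 1) → S =>
        t * ptGraphSwap μ (fun r : Fin m => (((0 : Fin (K + 1)), (κ r).succ) : Fin (K + 1) × Fin (K + 1))) φ y z
          + (1 - t) * prodKernel w M y z) ≤ 2 * m / (t * (1 - t) * (a * w 0) * c) := by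
  have hmpos : (0 : ℝ) < m := Nat.cast_pos.mpr (by omega)
  have hcpos : (0 : ℝ) < c := Nat.cast_pos.mpr (by omega)
  have h1t : 0 < 1 - t := by linarith
  have hgap := doeblinPerfectStar_absSpectralGap_ge κ φ hm ht0 ht1 hw0 hw00 hw1 hμ hμ1 hM hMrev ha0 ha1 hmin hperf hc1 hc
    hcm
  have hpos : 0 < t * (1 - t) * (a * w 0) * c / (2 * m) := by positivity
  unfold relaxationTime
  calc 1 / absSpectralGap _ ≤ 1 / (t * (1 - t) * (a * w 0) * c / (2 * m)) := one_div_le_one_div_of_le hpos hgap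
    _ = 2 * m / (t * (1 - t) * (a * w 0) * c) := by rw [one_div_div]

end Gap

end Summit.Ventures.LatticeQCDFlow.Scaling

end
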